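import Summits.ValiantsHypothesis.ValiantsHypothesis.Theorems.KPlusLogSqLawTropicalBCyclePotential

/-!
# Route «KPlusLogSqLaw», crux `TropicalB` (stmt-ValiantsHypothesis-19771) — THE CYCLE POTENTIAL LAW AT `K = 4`, EXPONENT-FREE:
# every four-class design admits a 2-compatible class potential of height `9`, so a dominant chain with `J` steps having a
# `3⁺`-cycle has `n + 1 ≤ (J + 1)·(9m + 1)` — whatever the exponents, valuations and support

HONEST FRAMING.  Helper toward the registered stubs `stub_tropThin` / `stub_tropFat` of `Cruxes/TropicalB/Lines/birth.lean` (crux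
`Summit.ValiantsHypothesis.ValiantsHypothesis.Theses.KPlusLogSqLaw.TropicalB`, item stmt-ValiantsHypothesis-19771, route KPlusLogSqLaw;
cell `pub-symmetroid`, seat val-sym-trop-p1 g24, 2026-08-29; `--supports … --as helper`).  A STRUCTURE law for the `K = 4` growth fork
(`TropicalCensus.TropK4Law 2` vs `¬ TropK4Law 2`, D2) derived from the cycle potential law (`CyclePotential.chain_le_of_exceptions`,
…TropicalBCyclePotential); it decides nothing about the fork, bounds nothing for `TropicalB` in its window, and bears on neither `WeakLifting`,
DoorA26 / DoorA34, `MatrixDescartes` (stmt-ValiantsHypothesis-18050) nor VP ≠ VNP.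

THE POINT.  The cycle potential law needs a `c`-COMPATIBLE class potential (`Σ_B d∘f < Σ_B d∘g ⇒ Σ_B u∘f < Σ_B u∘g` on column sets `#B ≤ c`);
part 1 supplied one of height `(c+1)^{K−1} − 1` for `c`-LACUNARY exponents.  At `K = 4`, `c = 2` NO hypothesis on the exponents is needed:

* `pairCompat_of_signs` — for sorted `d₀ ≤ d₁ ≤ d₂ ≤ d₃` and strictly increasing `u`, 2-compatibility in pair form
  (`dᵢ + dⱼ < dₖ + dₗ ⇒ uᵢ + uⱼ < uₖ + uₗ`, all `i j k l : Fin 4`) follows from sign-compatibility on the FIVE comparisons not forced by sorting: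
  `2d₁ : d₀+d₂`, `2d₂ : d₁+d₃`, `d₀+d₃ : d₁+d₂`, `2d₁ : d₀+d₃`, `2d₂ : d₀+d₃` (256 index cases, `omega`);
* `exists_signCompat_four` — **every sorted integer quadruple admits such a `u` with `0 = u₀ < u₁ < u₂ < u₃ ≤ 9`** (decision tree on the five
  signs, 29 feasible sign patterns, a witness in each leaf; e.g. `(0,4,6,7)` for the GRW pattern, `(0,3,5,9)` / `(0,2,5,9)` / `(0,4,7,9)` /
  `(0,4,6,9)` for the four patterns that need the full height `9`; infeasible leaves by `omega`) — the seat's located constant `H*(4,2) = 9`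
  (py/hstar.py) is now KERNEL;
* `pairCompat_to_finset` (any `K`, `m`): pair-form 2-compatibility ⇒ the column-set form on `#B ≤ 2` used by the law;
* `exists_twoCompatible_four` — for EVERY `d : Fin 4 → ℕ` a 2-compatible class potential with values in `[0, 9]` (sort `d` by `Tuple.sort`);
* `chain_le_four_of_exceptions` — **for every design of format `(m, 4)` and every dominant chain (distinct consecutive terms) whose steps outside
  an exceptional set `J` have exchange quotients with all orbits of size `≤ 2` (products of disjoint transpositions, plus class changes):
  `n + 1 ≤ (#J + 1)·(9m + 1)`**; `chain_le_four_involutions` — all steps involutive ⇒ `n ≤ 9m`; `chain_le_four_of_shortSteps` — steps outside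
  `J` change at most two columns ⇒ the same bound.

READING for the fork (nothing decided): a CUBIC `(m,4)` family (`T(m,4) = Ω(m³)`) must have, in its long chains, `#J ≥ (n+1)/(9m+1) − 1 = Ω(m²)`
steps whose exchange permutation contains a cycle of length `≥ 3` — for EVERY exponent vector.  Calibration (located, seat memo
CYCLE-POTENTIAL-g24.md §2): the quadratic GRW family has exactly `2m − 2` such steps (`m + 1` full rotations among them); the analogous located
constants for longer cycles are `H*(4,3) = 22`, `H*(4,4) = 41` (not formalised).  [this file]
-/

set_option linter.dupNamespace false
set_option autoImplicit false

namespace Summit.ValiantsHypothesis.ValiantsHypothesis.Theorems.KPlusLogSqLaw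

open Summit.ValiantsHypothesis.ValiantsHypothesis.Theorems.MatrixDescartes.Negative
open scoped BigOperators
open Finset

namespace CyclePotential

/-! ## 1. Pair compatibility from five signs (sorted exponents) -/

/-- **Five signs suffice.**  For sorted `d₀ ≤ d₁ ≤ d₂ ≤ d₃` and strictly increasing `u`, sign-compatibility on the five comparisons not forced by
sorting gives pair-form 2-compatibility. [this file] -/
theorem pairCompat_of_signs (d0 d1 d2 d3 u0 u1 u2 u3 : ℤ) (hd : d0 ≤ d1 ∧ d1 ≤ d2 ∧ d2 ≤ d3)
    (hu : u0 < u1 ∧ u1 < u2 ∧ u2 < u3)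
    (hA : (d0 + d2 < d1 + d1 → u0 + u2 < u1 + u1) ∧ (d1 + d1 < d0 + d2 → u1 + u1 < u0 + u2))
    (hB : (d1 + d3 < d2 + d2 → u1 + u3 < u2 + u2) ∧ (d2 + d2 < d1 + d3 → u2 + u2 < u1 + u3))
    (hC : (d1 + d2 < d0 + d3 → u1 + u2 < u0 + u3) ∧ (d0 + d3 < d1 + d2 → u0 + u3 < u1 + u2))
    (hD : (d0 + d3 < d1 + d1 → u0 + u3 < u1 + u1) ∧ (d1 + d1 < d0 + d3 → u1 + u1 < u0 + u3))
    (hE : (d0 + d3 < d2 + d2 → u0 + u3 < u2 + u2) ∧ (d2 + d2 < d0 + d3 → u2 + u2 < u0 + u3)) :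
    ∀ i j k l : Fin 4, ![d0, d1, d2, d3] i + ![d0, d1, d2, d3] j < ![d0, d1, d2, d3] k + ![d0, d1, d2, d3] l →
      ![u0, u1, u2, u3] i + ![u0, u1, u2, u3] j < ![u0, u1, u2, u3] k + ![u0, u1, u2, u3] l := by
  obtain ⟨hd1, hd2, hd3⟩ := hd
  obtain ⟨hu1, hu2, hu3⟩ := hu
  obtain ⟨hA1, hA2⟩ := hA
  obtain ⟨hB1, hB2⟩ := hB
  obtain ⟨hC1, hC2⟩ := hC
  obtain ⟨hD1, hD2⟩ := hD
  obtain ⟨hE1, hE2⟩ := hE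
  intro i j k l
  fin_cases i <;> fin_cases j <;> fin_cases k <;> fin_cases l <;> simp <;> omega

/-! ## 2. The witness: height `9` for every sorted quadruple (`H*(4,2) = 9`) -/

/-- **Every sorted integer quadruple admits a sign-compatible `u` with `0 = u₀ < u₁ < u₂ < u₃ ≤ 9`.**  Decision tree on the signs of
`d₀+d₃ − d₁−d₂`, `2d₁ − d₀−d₂`, `2d₂ − d₁−d₃`, `2d₁ − d₀−d₃`, `2d₂ − d₀−d₃`; a witness in each of the 29 feasible leaves. [this file] -/
theorem exists_signCompat_four (d0 d1 d2 d3 : ℤ) (h01 : d0 ≤ d1) (h12 : d1 ≤ d2) (h23 : d2 ≤ d3) :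
    ∃ u1 u2 u3 : ℤ, (0 < u1 ∧ u1 < u2 ∧ u2 < u3 ∧ u3 ≤ 9) ∧
      ((d0 + d2 < d1 + d1 → 0 + u2 < u1 + u1) ∧ (d1 + d1 < d0 + d2 → u1 + u1 < 0 + u2)) ∧
      ((d1 + d3 < d2 + d2 → u1 + u3 < u2 + u2) ∧ (d2 + d2 < d1 + d3 → u2 + u2 < u1 + u3)) ∧
      ((d1 + d2 < d0 + d3 → u1 + u2 < 0 + u3) ∧ (d0 + d3 < d1 + d2 → 0 + u3 < u1 + u2)) ∧
      ((d0 + d3 < d1 + d1 → 0 + u3 < u1 + u1) ∧ (d1 + d1 < d0 + d3 → u1 + u1 < 0 + u3)) ∧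
      ((d0 + d3 < d2 + d2 → 0 + u3 < u2 + u2) ∧ (d2 + d2 < d0 + d3 → u2 + u2 < 0 + u3)) := by
    · rcases lt_trichotomy (d1 + d2) (d0 + d3) with hC | hC | hC
      · rcases lt_trichotomy (d0 + d2) (d1 + d1) with hA | hA | hA
        · rcases lt_trichotomy (d1 + d3) (d2 + d2) with hB | hB | hB
          · exfalso; omega
          · exfalso; omega
          · rcases lt_trichotomy (d0 + d3) (d1 + d1) with hD | hD | hD
            · exfalso; omega
            · exfalso; omega
            · rcases lt_trichotomy (d0 + d3) (d2 + d2) with hE | hE | hE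
              · exact ⟨3, 5, 9, by omega⟩
              · exact ⟨2, 3, 6, by omega⟩
              · exact ⟨2, 3, 7, by omega⟩
        · rcases lt_trichotomy (d1 + d3) (d2 + d2) with hB | hB | hB
          · exfalso; omega
          · exfalso; omega
          · rcases lt_trichotomy (d0 + d3) (d1 + d1) with hD | hD | hD
            · exfalso; omega
            · exfalso; omega
            · rcases lt_trichotomy (d0 + d3) (d2 + d2) with hE | hE | hE
              · exact ⟨2, 4, 7, by omega⟩
              · exact ⟨1, 2, 4, by omega⟩
              · exact ⟨1, 2, 5, by omega⟩
        · rcases lt_trichotomy (d1 + d3) (d2 + d2) with hB | hB | hB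
          · exact ⟨1, 4, 6, by omega⟩
          · exact ⟨1, 3, 5, by omega⟩
          · rcases lt_trichotomy (d0 + d3) (d1 + d1) with hD | hD | hD
            · exfalso; omega
            · exfalso; omega
            · rcases lt_trichotomy (d0 + d3) (d2 + d2) with hE | hE | hE
              · exact ⟨2, 5, 9, by omega⟩
              · exact ⟨1, 3, 6, by omega⟩
              · exact ⟨1, 3, 7, by omega⟩
      · rcases lt_trichotomy (d0 + d2) (d1 + d1) with hA | hA | hA
        · exact ⟨2, 3, 5, by omega⟩
        · exact ⟨1, 2, 3, by omega⟩
        · exact ⟨1, 3, 4, by omega⟩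
      · rcases lt_trichotomy (d0 + d2) (d1 + d1) with hA | hA | hA
        · rcases lt_trichotomy (d1 + d3) (d2 + d2) with hB | hB | hB
          · rcases lt_trichotomy (d0 + d3) (d1 + d1) with hD | hD | hD
            · exact ⟨4, 6, 7, by omega⟩
            · exact ⟨3, 5, 6, by omega⟩
            · exact ⟨4, 7, 9, by omega⟩
          · rcases lt_trichotomy (d0 + d3) (d1 + d1) with hD | hD | hD
            · exact ⟨3, 4, 5, by omega⟩
            · exact ⟨2, 3, 4, by omega⟩
            · exact ⟨3, 5, 7, by omega⟩
          · rcases lt_trichotomy (d0 + d3) (d1 + d1) with hD | hD | hD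
            · exact ⟨4, 5, 7, by omega⟩
            · exact ⟨3, 4, 6, by omega⟩
            · exact ⟨4, 6, 9, by omega⟩
        · exact ⟨2, 4, 5, by omega⟩
        · exact ⟨2, 5, 6, by omega⟩

/-! ## 3. From pair form to column sets of size `≤ 2` (any format) -/

/-- pair-form 2-compatibility ⇒ the column-set form on `#B ≤ 2` consumed by the cycle potential law. [this file] -/
theorem pairCompat_to_finset {m K : ℕ} (d : Fin K → ℕ) (u : Fin K → ℤ)
    (hp : ∀ i j k l : Fin K, (d i : ℤ) + d j < d k + d l → u i + u j < u k + u l)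
    (B : Finset (Fin m)) (hB : B.card ≤ 2) (f g : Fin m → Fin K)
    (hlt : ∑ b ∈ B, (d (f b) : ℤ) < ∑ b ∈ B, (d (g b) : ℤ)) :
    ∑ b ∈ B, u (f b) < ∑ b ∈ B, u (g b) := by
  classical
  have hc : B.card = 0 ∨ B.card = 1 ∨ B.card = 2 := by omega
  rcases hc with hc | hc | hc
  · rw [Finset.card_eq_zero] at hc
    subst hc
    simp at hlt
  · obtain ⟨b, rfl⟩ := Finset.card_eq_one.mp hc
    rw [sum_singleton, sum_singleton] at hlt ⊢
    have h := hp (f b) (f b) (g b) (g b) (by linarith)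
    linarith
  · obtain ⟨x, y, hxy, rfl⟩ := Finset.card_eq_two.mp hc
    rw [sum_pair hxy, sum_pair hxy] at hlt ⊢
    exact hp (f x) (f y) (g x) (g y) hlt

/-! ## 4. Every four-class exponent vector admits a 2-compatible potential of height `9` -/

/-- a `Fin 4`-vector is the vector literal of its values. [folklore] -/
theorem vec_four_eq (w : Fin 4 → ℤ) : ![w 0, w 1, w 2, w 3] = w := by
  funext i
  fin_cases i <;> rfl

/-- **For every `d : Fin 4 → ℕ` there is a 2-compatible class potential with values in `[0, 9]`.** [this file] -/
theorem exists_twoCompatible_four {m : ℕ} (d : Fin 4 → ℕ) :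
    ∃ u : Fin 4 → ℤ, (∀ l, 0 ≤ u l ∧ u l ≤ 9) ∧
      ∀ B : Finset (Fin m), B.card ≤ 2 → ∀ f g : Fin m → Fin 4,
        ∑ b ∈ B, (d (f b) : ℤ) < ∑ b ∈ B, (d (g b) : ℤ) → ∑ b ∈ B, u (f b) < ∑ b ∈ B, u (g b) := by
  classical
  -- sort the exponents
  set σ : Equiv.Perm (Fin 4) := Tuple.sort d with hσ
  have hmono : Monotone (d ∘ σ) := Tuple.monotone_sort d
  set e : Fin 4 → ℤ := fun i => (d (σ i) : ℤ) with he
  have he_mono : ∀ i j : Fin 4, i ≤ j → e i ≤ e j := fun i j hij => by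
    simp only [he]
    exact_mod_cast hmono hij
  obtain ⟨u1, u2, u3, hu, hA, hB, hC, hD, hE⟩ := exists_signCompat_four (e 0) (e 1) (e 2) (e 3)
    (he_mono 0 1 (by decide)) (he_mono 1 2 (by decide)) (he_mono 2 3 (by decide))
  -- the sorted potential and its pair compatibility
  have hpair := pairCompat_of_signs (e 0) (e 1) (e 2) (e 3) 0 u1 u2 u3
    ⟨he_mono 0 1 (by decide), he_mono 1 2 (by decide), he_mono 2 3 (by decide)⟩ ⟨hu.1, hu.2.1, hu.2.2.1⟩ hA hB hC hD hE
  rw [vec_four_eq e] at hpair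
  set w : Fin 4 → ℤ := ![0, u1, u2, u3] with hw
  -- unsort: `u := w ∘ σ⁻¹`
  refine ⟨fun l => w (σ⁻¹ l), fun l => ?_, ?_⟩
  · have : ∀ i : Fin 4, 0 ≤ w i ∧ w i ≤ 9 := by
      intro i
      fin_cases i <;> simp [hw] <;> omega
    exact this _
  · intro B hB f g hlt
    refine pairCompat_to_finset (m := m) d (fun l => w (σ⁻¹ l)) (fun i j k l h => ?_) B hB f g hlt
    have h' : e (σ⁻¹ i) + e (σ⁻¹ j) < e (σ⁻¹ k) + e (σ⁻¹ l) := by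
      simpa [he] using h
    exact hpair _ _ _ _ h'

/-! ## 5. The exponent-free law at `K = 4` -/

variable {m : ℕ} (d : Fin 4 → ℕ) (v ε : Fin m → Fin m → Fin 4 → ℤ)

/-- **CYCLE POTENTIAL LAW AT `K = 4`, EXPONENT-FREE.**  In every design of format `(m, 4)`, a chain of terms dominant at strictly increasing
slopes with consecutive terms distinct, whose steps outside `J` have exchange quotients with all orbits of size `≤ 2`, has
`n + 1 ≤ (#J + 1)·(9m + 1)`. [this file] -/
theorem chain_le_four_of_exceptions {n : ℕ} (θ : Fin (n + 1) → ℤ)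
    (p : Fin (n + 1) → Equiv.Perm (Fin m) × (Fin m → Fin 4))
    (hθ : StrictMono θ) (hdom : ∀ k, IsDominant d v ε (θ k) (p k)) (hne : ∀ k : Fin n, p k.castSucc ≠ p k.succ)
    (J : Finset (Fin n))
    (horb : ∀ k : Fin n, k ∉ J → ∀ b : Fin m, ∃ T : Finset (Fin m), b ∈ T ∧ T.card ≤ 2 ∧
      ∀ x, ((p k.castSucc).1⁻¹ * (p k.succ).1) x ∈ T ↔ x ∈ T) :
    n + 1 ≤ (J.card + 1) * (9 * m + 1) := by
  obtain ⟨u, hU, hu⟩ := exists_twoCompatible_four (m := m) d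
  have h := chain_le_of_exceptions d v ε 2 u hu 0 9 hU θ p hθ hdom hne J horb
  have h' : ((n : ℕ) : ℤ) + 1 ≤ (((J.card + 1) * (9 * m + 1) : ℕ) : ℤ) := by push_cast; linarith
  exact_mod_cast h'

/-- **Involutive steps are linear at `K = 4`.**  If every step's exchange quotient has all orbits of size `≤ 2` (a product of disjoint
transpositions, plus class changes), then `n ≤ 9m` — in every design of format `(m, 4)`. [this file] -/
theorem chain_le_four_involutions {n : ℕ} (θ : Fin (n + 1) → ℤ)
    (p : Fin (n + 1) → Equiv.Perm (Fin m) × (Fin m → Fin 4))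
    (hθ : StrictMono θ) (hdom : ∀ k, IsDominant d v ε (θ k) (p k)) (hne : ∀ k : Fin n, p k.castSucc ≠ p k.succ)
    (horb : ∀ k : Fin n, ∀ b : Fin m, ∃ T : Finset (Fin m), b ∈ T ∧ T.card ≤ 2 ∧
      ∀ x, ((p k.castSucc).1⁻¹ * (p k.succ).1) x ∈ T ↔ x ∈ T) :
    n ≤ 9 * m := by
  have h := chain_le_four_of_exceptions d v ε θ p hθ hdom hne ∅ (fun k _ b => horb k b)
  simp only [card_empty, zero_add, one_mul] at h
  omega

/-- **Steps changing at most two columns.**  If every step outside `J` changes at most two columns (in row or class), then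
`n + 1 ≤ (#J + 1)·(9m + 1)` — in every design of format `(m, 4)`. [this file] -/
theorem chain_le_four_of_shortSteps {n : ℕ} (θ : Fin (n + 1) → ℤ)
    (p : Fin (n + 1) → Equiv.Perm (Fin m) × (Fin m → Fin 4))
    (hθ : StrictMono θ) (hdom : ∀ k, IsDominant d v ε (θ k) (p k)) (hne : ∀ k : Fin n, p k.castSucc ≠ p k.succ)
    (J : Finset (Fin n))
    (hstep : ∀ k : Fin n, k ∉ J → (univ.filter fun i : Fin m =>
      (p k.castSucc).1 i ≠ (p k.succ).1 i ∨ (p k.castSucc).2 i ≠ (p k.succ).2 i).card ≤ 2) :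
    n + 1 ≤ (J.card + 1) * (9 * m + 1) :=
  chain_le_four_of_exceptions d v ε θ p hθ hdom hne J
    fun k hk b => exists_invariant_of_shortStep 2 (by norm_num) (p k.castSucc) (p k.succ) (hstep k hk) b

end CyclePotential

end Summit.ValiantsHypothesis.ValiantsHypothesis.Theorems.KPlusLogSqLaw
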